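import Literature.NumberTheory.GaloisRepresentations.LabelledHodgeTateWeights
import Literature.NumberTheory.GaloisRepresentations.CoefficientEigenspaces
import HarnessLib

/-!
# The `E ⊗ F`-module structure of `D(ρ)` with coefficients

For a period-ring datum `𝔅` (invariants `F`, prime field `P`), a coefficient field `E ⊇ P` and an
`E`-linear representation `ρ` on `M`, the invariants `D(ρ) = (M ⊗_P B)^Γ` (`PeriodRingData.coeffD`)
carry commuting actions of `E` (through `M`) and of `F` (through `B`, `PeriodRingData.baseAct`).
This file packages the `F`-action as a `P`-algebra homomorphism (`baseActAlgHom`, `coeffDAct`),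
identifies the `τ`-components `PeriodRingData.labelD ρ τ` with the eigenspaces
`CoeffEigen.eigenSub` of `CoefficientEigenspaces` (`mem_eigenSub_coeffDAct_iff`,
`finrank_eigenSub_coeffDAct`), and records the action of `B` on the right factor (`baseActB`)
and its transport under `TensorProduct.comm` (`comm_symm_smul`).  Pure bookkeeping; no named
facts, no `sorry`.

## References

* S. Patrikis, *Variations on a theorem of Tate*, Mem. AMS 258 (2019), §2.3.1. [Patrikis2019]
-/

noncomputable section

open TensorProduct

namespace Literature.NumberTheory.GaloisRepresentations

namespace PeriodRingData

universe u v v'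

section BaseAct

variable {Γ : Type u} [Group Γ] {P : Type v} {F : Type v'} [Field P] [Field F] [Algebra P F]
  (E : Type*) [Field E] [Algebra P E]
  (M : Type*) [AddCommGroup M] [Module E M] [Module P M] [IsScalarTower P E M]
  (𝔅 : PeriodRingData.{u, v, v', _} Γ P F)

/-- **The `F`-action on `M ⊗_P B` as a `P`-algebra homomorphism** `F → End_E (M ⊗_P B)`,
`f ↦ id ⊗ (f • ·)` (`PeriodRingData.baseAct`). [folklore] -/
def baseActAlgHom : F →ₐ[P] Module.End E (M ⊗[P] 𝔅.B) where
  toFun f := 𝔅.baseAct E M f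
  map_one' := by
    refine TensorProduct.AlgebraTensorModule.ext fun m b => ?_
    rw [baseAct_tmul, one_smul, Module.End.one_apply]
  map_mul' f g := by
    refine TensorProduct.AlgebraTensorModule.ext fun m b => ?_
    rw [baseAct_tmul, Module.End.mul_apply, baseAct_tmul, baseAct_tmul, mul_smul]
  map_zero' := by
    refine TensorProduct.AlgebraTensorModule.ext fun m b => ?_
    rw [baseAct_tmul, zero_smul, tmul_zero, LinearMap.zero_apply]
  map_add' f g := by
    refine TensorProduct.AlgebraTensorModule.ext fun m b => ?_
    rw [baseAct_tmul, LinearMap.add_apply, baseAct_tmul, baseAct_tmul, add_smul, tmul_add]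
  commutes' c := by
    refine TensorProduct.AlgebraTensorModule.ext fun m b => ?_
    rw [baseAct_tmul, Module.algebraMap_end_apply, algebraMap_smul, TensorProduct.smul_tmul', TensorProduct.smul_tmul]

/-- Unfolding lemma for `baseActAlgHom`. [folklore] -/
@[simp] theorem baseActAlgHom_apply (f : F) : 𝔅.baseActAlgHom E M f = 𝔅.baseAct E M f := rfl

/-- **The action of `B` on the right factor** of `M ⊗_P B`, `b' ↦ id ⊗ (b' · )`, `E`-linear. [folklore] -/
def baseActB (b : 𝔅.B) : M ⊗[P] 𝔅.B →ₗ[E] M ⊗[P] 𝔅.B :=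
  AlgebraTensorModule.map LinearMap.id (LinearMap.mulLeft P b)

/-- Unfolding lemma for `baseActB` on pure tensors. [folklore] -/
@[simp] theorem baseActB_tmul (b : 𝔅.B) (m : M) (c : 𝔅.B) : 𝔅.baseActB E M b (m ⊗ₜ[P] c) = m ⊗ₜ[P] (b * c) := rfl

/-- On `F ⊆ B` the two actions agree. [folklore] -/
theorem baseActB_algebraMap (f : F) (x : M ⊗[P] 𝔅.B) : 𝔅.baseActB E M (algebraMap F 𝔅.B f) x = 𝔅.baseAct E M f x := by
  induction x using TensorProduct.induction_on with
  | zero => simp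
  | tmul m b => rw [baseActB_tmul, baseAct_tmul, Algebra.smul_def]
  | add x y hx hy => rw [map_add, map_add, hx, hy]

/-- `TensorProduct.comm` turns the `B`-module structure of `B ⊗_P M` into `baseActB`. [folklore] -/
theorem comm_symm_smul (b : 𝔅.B) (y : 𝔅.B ⊗[P] M) :
    (TensorProduct.comm P M 𝔅.B).symm (b • y) = 𝔅.baseActB E M b ((TensorProduct.comm P M 𝔅.B).symm y) := by
  induction y using TensorProduct.induction_on with
  | zero => simp
  | tmul c m => rfl
  | add x y hx hy => rw [smul_add, map_add, hx, hy, map_add, map_add]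

/-- `baseActB b` commutes with `baseAct f` (`B` is commutative). [folklore] -/
theorem baseActB_baseAct (b : 𝔅.B) (f : F) (x : M ⊗[P] 𝔅.B) :
    𝔅.baseActB E M b (𝔅.baseAct E M f x) = 𝔅.baseAct E M f (𝔅.baseActB E M b x) := by
  induction x using TensorProduct.induction_on with
  | zero => simp
  | tmul m c => rw [baseAct_tmul, baseActB_tmul, baseActB_tmul, baseAct_tmul, mul_smul_comm]
  | add x y hx hy => simp only [map_add, hx, hy]

end BaseAct

section CoeffD

variable {Γ : Type u} [Group Γ] [TopologicalSpace Γ] {P : Type v} {F : Type v'} [Field P] [Field F] [Algebra P F]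
  {E : Type*} [Field E] [Algebra P E] [TopologicalSpace E]
  {M : Type*} [AddCommGroup M] [Module E M] [Module P M] [IsScalarTower P E M] [TopologicalSpace M]
  (𝔅 : PeriodRingData.{u, v, v', _} Γ P F) (ρ : ContinuousRep Γ E M)

/-- **The `F`-action on `D(ρ) = (M ⊗_P B)^Γ`** (`D` is `F`-stable, `baseAct_mem_coeffD`), as a
`P`-algebra homomorphism `F → End_E D(ρ)`: the `E ⊗_P F`-module structure of `D(ρ)`.
[cite: Patrikis2019, §2.3.1] -/
def coeffDAct : F →ₐ[P] Module.End E (𝔅.coeffD ρ) where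
  toFun f := (𝔅.baseAct E M f).restrict fun x hx => 𝔅.baseAct_mem_coeffD ρ f hx
  map_one' := LinearMap.ext fun x => Subtype.ext (by
    change 𝔅.baseActAlgHom E M 1 x = x
    rw [map_one]; rfl)
  map_mul' f g := LinearMap.ext fun x => Subtype.ext (by
    change 𝔅.baseActAlgHom E M (f * g) x = 𝔅.baseActAlgHom E M f (𝔅.baseActAlgHom E M g x)
    rw [map_mul]; rfl)
  map_zero' := LinearMap.ext fun x => Subtype.ext (by
    change 𝔅.baseActAlgHom E M 0 x = 0
    rw [map_zero]; rfl)
  map_add' f g := LinearMap.ext fun x => Subtype.ext (by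
    change 𝔅.baseActAlgHom E M (f + g) x = 𝔅.baseActAlgHom E M f x + 𝔅.baseActAlgHom E M g x
    rw [map_add]; rfl)
  commutes' c := LinearMap.ext fun x => Subtype.ext (by
    change 𝔅.baseActAlgHom E M (algebraMap P F c) x = ((algebraMap P (Module.End E (𝔅.coeffD ρ)) c) x : M ⊗[P] 𝔅.B)
    rw [AlgHom.commutes, Module.algebraMap_end_apply, Module.algebraMap_end_apply, Submodule.coe_smul_of_tower])

/-- Unfolding lemma for `coeffDAct`. [folklore] -/
@[simp] theorem coe_coeffDAct_apply (f : F) (x : 𝔅.coeffD ρ) :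
    ((𝔅.coeffDAct ρ f x : 𝔅.coeffD ρ) : M ⊗[P] 𝔅.B) = 𝔅.baseAct E M f x := rfl

/-- **The eigenspaces of the `F`-action on `D(ρ)` are the `τ`-components `D_τ`.** [folklore] -/
theorem mem_eigenSub_coeffDAct_iff (τ : F →ₐ[P] E) (x : 𝔅.coeffD ρ) :
    x ∈ CoeffEigen.eigenSub (𝔅.coeffDAct ρ) τ ↔ (x : M ⊗[P] 𝔅.B) ∈ 𝔅.labelD ρ τ.toRingHom := by
  rw [CoeffEigen.mem_eigenSub_iff, mem_labelD_iff]
  simp only [Subtype.ext_iff, coe_coeffDAct_apply, Submodule.coe_smul, AlgHom.toRingHom_eq_coe, RingHom.coe_coe]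
  exact ⟨fun h => ⟨x.2, h⟩, fun h => h.2⟩

/-- The `τ`-eigenspace of `D(ρ)` is linearly equivalent to `D_τ`. [folklore] -/
def eigenSubEquivLabelD (τ : F →ₐ[P] E) : CoeffEigen.eigenSub (𝔅.coeffDAct ρ) τ ≃ₗ[E] 𝔅.labelD ρ τ.toRingHom where
  toFun x := ⟨(x : 𝔅.coeffD ρ), (𝔅.mem_eigenSub_coeffDAct_iff ρ τ x).1 x.2⟩
  map_add' _ _ := rfl
  map_smul' _ _ := rfl
  invFun y := ⟨⟨y, 𝔅.labelD_le_coeffD ρ _ y.2⟩, (𝔅.mem_eigenSub_coeffDAct_iff ρ τ _).2 y.2⟩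
  left_inv _ := rfl
  right_inv _ := rfl

/-- **`dim_E (e_τ D(ρ)) = dim_E D_τ(ρ)`.** [folklore] -/
theorem finrank_eigenSub_coeffDAct (τ : F →ₐ[P] E) :
    Module.finrank E (CoeffEigen.eigenSub (𝔅.coeffDAct ρ) τ) = Module.finrank E (𝔅.labelD ρ τ.toRingHom) :=
  (𝔅.eigenSubEquivLabelD ρ τ).finrank_eq

end CoeffD

end PeriodRingData

end Literature.NumberTheory.GaloisRepresentations

end
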